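/-
Copyright (c) 2026 the pub-hodgecm-mathlib formalisation cell (harness21).  Prover seat hodgecm-mathlib-K2E1-p16 (g3), Track B ∕ K2-LIT, h413 = `stmt-HodgeConjecture-24833`,
R90-TF section S8 «ContSpec-n½», socket B MID :358, deals S8-R205 (2) ∕ S8-R210 (2) ∕ S8-R215 ∕ S8-R218 «(V) OF RECORD ED. 7»: the SEQUEL of ★ p864046 ∕ … ∕ ★ p864451
`resGMidBlock_ne_bot_of_ledger_letters` with (1) the LEVEL OF RECORD by name (K2E1-p11 ★ p863976 ∕ p864091 ∕ p864141), (2) the pole ledger's two letters PAID BY NAME by ONE head ★ `ledgerLetters_of_exports` (S8-R210 (2)) from THREE untwisted letters `hE6 hMSP′ hMS32`, (3) `A` FULLY NAMED (finite half at the 𝔫-balls × shifted archimedean witness) and `hA32` by ★ p864366 (`hA32_shifted_of_record_at_basePoint`, `hm1`-free).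
-/
import Summits.HodgeConjecture.HodgeConjecture.Theorems.R90S8ResGMidBlockNeBotOfLedgerU3                 -- ★ p864046 (K2E1-p15): (V) OF RECORD ED. 2 `resGMidBlock_ne_bot_of_ledger_letters`
import Summits.HodgeConjecture.HodgeConjecture.Theorems.R90S8ChiSectionPairNormBoundU3                   -- ★ p864091 (K2E1-p11): `omegaOfRecord_one`, `omegaOfRecord_mul` (+ ★ p863976 `levelOfRecord_le`, …)
import Summits.HodgeConjecture.HodgeConjecture.Theorems.R90S8ChiSectionPairLevelOfRecordStructureU3     -- ★ p864141 (K2E1-p11): `continuous_of_mem_chiSectionSpace_levelOfRecord`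
import Summits.HodgeConjecture.HodgeConjecture.Theorems.K2E1ChiEisensteinLedgerLettersOfExportsCMThree    -- ★ (this seat, S8-R210 (2)): `ledgerLetters_of_exports` (the pole-ledger column in ONE head; brings ★ p864057, ★ p864271)
import Summits.HodgeConjecture.HodgeConjecture.Theorems.K2E1ChiArchA32ShiftedOfRecordU3                 -- ★ p864366 + ED. 2 (R90-CS-p03): `hA32_shifted_of_record_at_basePoint_of_modEq` (fully named `A` at the mid-block table, parity `hk`)
import HarnessLib

/-!
# S8 socket B MID — `R90S8ResGMidBlockNeBotOfRecordV7U3` ((V) OF RECORD, ED. 7): `LHalfNeZero (ξ.bcη⁻¹·μω) → resGMidBlock L μ ξ μω ≠ ⊥` at the LEVEL OF RECORD, the pole ledger's two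
# letters and `hA32` FED BY NAME

Track B ∕ K2-LIT, crux h413 = `stmt-HodgeConjecture-24833`, route of record `HCCMUnconditional`; cell `hodgecm-mathlib`, R90-TF programme, section S8 «ContSpec-n½», socket B MID :358
∕ (V).  THEOREMS ONLY (no `def`, no `instance`, no `notation`, no named-fact hypothesis, no `sorry`; default heartbeats); lane `--supports stmt-HodgeConjecture-24833 --as helper`
(count-neutral).  CLOSES NO SOCKET (OF-RECORD ≠ payment).  ★ p864046 `resGMidBlock_ne_bot_of_ledger_letters` is called BY NAME with:
(1) `K′ := levelOfRecord K(𝔫)_f` AT THE PRINCIPAL CONGRUENCE LEVEL `K_f := finCongruenceLevel 𝔫`, `𝔫 ≠ 0` (open ★ `isOpen_finCongruenceLevel`, `≤ G(𝒪̂)_f` ★ `finCongruenceLevel_le_integralLevel`),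
`U₀ := K_f(𝔫) ≤ GL₃(𝔸_f)` (open compact, ★ `isOpen∕isCompact_comap_ofFinite_principalCongruenceLevel`; `U₀ ∩ G_f ⊆ K_f` definitionally), `ω₀ := ⟨omegaOfRecord (ξ.bcη⁻¹·μω) 1 K_f, …⟩ : K′ →* ℂ`,
`hK′ hKinf hU hVc` := K2E1-p11's ★ level lemmas, `hJ := antidiagonal_over_det_ne_zero`, `Mφ := 1`, the row-(ii) domain `D := ({1 < Re} ∖ {3∕2}) ∖ midWitnessP` BY NAME
— the witness section `φ₀` STAYS A BINDER (dealer ruling J-S8-WIT′: consumers `obtain` K2E1-p11's ★ witness inside their own proofs; no ∀-closure over `φ₀`);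
(2) `⟨hbddPK, hbdd32⟩ := ledgerLetters_of_exports …` (★, S8-R210 (2): `hEcinv`, `hSM`, `hSM32` discharged from ★ exports + ★ convData) — so the ledger is visible through THREE letters
about the UNTWISTED named family `midWitnessEc ∕ midWitnessP`: `hE6` ((E6) `L²` representatives off `P`), `hMSP′` ((MS-P′) near the candidate poles off `3∕2`, operator currency),
`hMS32` ((MS-3∕2) in `eLpNorm` form);
(3) `A := fun z ↦ (C·∏_{v∈S₀} ν_v(𝒪_v³)⁻¹ • ∫ 𝟙_{B_v(𝔫)}·Q_v^{−z}) · ∫_{L_∞}∫_{L⁺_∞} (∏_w ε_w·archUnitaryValue m_w 0 ζ_w·((2+ζ_w)∕ζ_w)^{p_w}·((2+conj ζ_w)∕conj ζ_w)^{q_w})·ARCH₃^{−z}` FULLY NAMED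
(★ p864366's lambda at `m_w := kμ,w − 2·ξ.eη w`, `p_w := ((m_w − 1)∕2).toNat`, `q_w := ((−m_w − 1)∕2).toNat`), `hA32 := hA32_shifted_of_record_at_basePoint` with the table clause
`hm := shiftExponents_spec … (odd_of_modEq_one_sub_two_mul hk)` (K2E1-p13 ★) — visible: the unit phases `ε hε1 hε0`, the parity `hk : kμ,w ≡ 1 [ZMOD 2]`, `S₀ 𝔫 C hC`.
Rows (ii) and (i′) are ★ p864046's binders VERBATIM (with the substituted level data inside the named family).
VISIBLE → PAYER: `hE6` ⇐ (E6) of ★ p863930 transported to the named family (downstream of (MS-P′));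
`hMSP′` ⇐ (MS-P′) OFF-AXIS; `hMS32` ⇐ ★ p863403 chain; `hE3 hfac` ⇐ ℓ-CT; `hsrc` ⇐ the unfolding row at `g₁ = ι_f(w₀^{S₀})` (CS-p03's supplier estate), `hk` ⇐ `μω.HasUnitaryArchType kμ 0` with `kμ` odd (★ `exists_blockExponents_of_hquad`); `Fam hFam hMS` ⇐ hCONT ∕ (MS-3∕2).
HONEST LABEL: HC_CM is proved only modulo the 7 printed citations (2 remaining named inputs: hLiu418 = `stmt-HodgeConjecture-24832`, h413 = `stmt-HodgeConjecture-24833`) until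
rung 0 closes; OF-RECORD ≠ payment — :358 stays `sorry` in B until every visible row is ★ and instantiated; REL ≠ ★ ≠ WRITTEN ≠ BUILT; count-neutral.

## References
* [Rogawski1990] J. D. Rogawski, *Automorphic Representations of Unitary Groups in Three Variables* (1990), §13.3 p. 202, §13.9 (ii) p. 229.
* [MoeglinWaldspurger1995] C. Mœglin, J.-L. Waldspurger, *Spectral Decomposition and Eisenstein Series* (1995), I.2.17, IV.1.8–IV.1.11, IV.3.12.
* [BorelJacquet1979] A. Borel, H. Jacquet, *Automorphic forms and automorphic representations*, Proc. Symp. Pure Math. 33.1 (1979), §4.1.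
* [BernsteinLapid2019] J. Bernstein, E. Lapid, *On the meromorphic continuation of Eisenstein series*, J. Amer. Math. Soc. 37 (2024), Thm 2.3.
-/

set_option autoImplicit false
set_option linter.dupNamespace false  -- the mandated namespace `…HodgeConjecture.HodgeConjecture.R90.S8` (LEAD #1 L1) repeats the summit's segment

noncomputable section

open MeasureTheory Measure NumberField IsDedekindDomain Set Filter Topology Metric
open scoped ENNReal NNReal MatrixGroups
open Literature.MeasureTheory.Group Literature.NumberTheory
open Literature.NumberTheory.Automorphic Literature.NumberTheory.Automorphic.UnitaryGroup Literature.NumberTheory.LFunctions Literature.NumberTheory.GaloisRepresentations AdelicGroupData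
open Literature.NumberTheory.Automorphic.Arthur2013.Leaves.TECR Literature.NumberTheory.Rogawski1990 ContRepresentation
open Summit.HodgeConjecture.HodgeConjecture.Cruxes.H413.K2E1BorelEisensteinU
open Summit.HodgeConjecture.HodgeConjecture.Cruxes.H413.K2E1BLBorelSpacesU2Defs
open Summit.HodgeConjecture.HodgeConjecture.Cruxes.H413.K2E1BLBorelOperatorsU2Defs
open Summit.HodgeConjecture.HodgeConjecture.Cruxes.H413.K2E1CharacterEisensteinU2Defs
open Summit.HodgeConjecture.HodgeConjecture.Cruxes.H413.K2E1ChiSectionSpaceU2Defs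
open Summit.HodgeConjecture.HodgeConjecture.Cruxes.H413.K2E1CharacterEisensteinU3PairDefs
open Summit.HodgeConjecture.HodgeConjecture.Cruxes.H413.K2E1ChiSectionSpaceU3PairDefs
open Summit.HodgeConjecture.HodgeConjecture.Cruxes.H413.K2E1HeckeLHalfNeZeroDefs (LHalfNeZero)
open Summit.HodgeConjecture.HodgeConjecture.Cruxes.H413.K2E1ChiEisensteinLedgerLettersOfExportsCMThree (ledgerLetters_of_exports)
open Summit.HodgeConjecture.HodgeConjecture.Cruxes.H413.K2E1ChiArchA32ShiftedOfRecordU3 (hA32_shifted_of_record_at_basePoint_of_modEq)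
open Literature.NumberTheory.GaloisRepresentations.IsNonarchimedeanLocalField
open Literature.NumberTheory.Automorphic.UnitaryGroup.AdelicCharactersDetQuasiSplit (antidiagonal_over_det_ne_zero)
open scoped ComplexConjugate

namespace Summit.HodgeConjecture.HodgeConjecture.R90.S8

variable (L : Type) [Field L] [NumberField L] [IsCMField L]
  [MeasurableSpace (quasiSplit (↥(maximalRealSubfield L)) L (IsCMField.complexConj L) 3).Adelic] [BorelSpace (quasiSplit (↥(maximalRealSubfield L)) L (IsCMField.complexConj L) 3).Adelic]
  [MeasurableSpace (arch (↥(maximalRealSubfield L)) L (IsCMField.complexConj L) 3 ((StdForm.antidiagonal 3).over L))] [BorelSpace (arch (↥(maximalRealSubfield L)) L (IsCMField.complexConj L) 3 ((StdForm.antidiagonal 3).over L))]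
  [MeasurableSpace (finAdelic (↥(maximalRealSubfield L)) L (IsCMField.complexConj L) 3 ((StdForm.antidiagonal 3).over L))] [BorelSpace (finAdelic (↥(maximalRealSubfield L)) L (IsCMField.complexConj L) 3 ((StdForm.antidiagonal 3).over L))]


/-- **(V) OF RECORD, ED. 7 — `LHalfNeZero (ξ.bcη⁻¹·μω) → resGMidBlock L μ ξ μω ≠ ⊥` AT THE PRINCIPAL CONGRUENCE LEVEL `K(𝔫)` (`U₀`, `D`, `hJ` by name), the pole ledger fed by ONE head, `A` FULLY NAMED**: ★ p864046
`resGMidBlock_ne_bot_of_ledger_letters` called with `K′ := levelOfRecord (finCongruenceLevel 𝔫)`, `U₀ := K_f(𝔫)`, `ω₀ := ⟨omegaOfRecord (ξ.bcη⁻¹·μω) 1 _, …⟩`, `hK′ hKinf hU hVc` := K2E1-p11's ★ level lemmas, `D` by name, `Mφ := 1`,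
`⟨hbddPK, hbdd32⟩ := ledgerLetters_of_exports …` on the THREE untwisted letters `hE6 hMSP′ hMS32` about the NAMED `midWitnessEc ∕ midWitnessP`, and `A := C_f·(archimedean double integral of record)`,
`hA32 := hA32_shifted_of_record_at_basePoint` (★ p864366).  The witness `φ₀` stays a binder (J-S8-WIT′).
[cite: Rogawski1990, §13.9 (ii) p. 229] [cite: MoeglinWaldspurger1995, IV.1.11, IV.3.12, I.2.17] [cite: BorelJacquet1979, §4.1] -/
theorem resGMidBlock_ne_bot_of_record_v7
    (μ : Measure (quasiSplit (↥(maximalRealSubfield L)) L (IsCMField.complexConj L) 3).automorphicQuotient) [(quasiSplit (↥(maximalRealSubfield L)) L (IsCMField.complexConj L) 3).IsAutomorphicMeasure μ]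
    (μω : HeckeCharacter L) (hμu : μω.IsUnitary)
    (hμω : ∀ x : ideleGroup ↥(maximalRealSubfield L), μω (AdeleRing.ideleBaseChange (↥(maximalRealSubfield L)) L x) = quadraticHeckeCharCM L x)
    (ξ : OneDimAutRepH L)
    -- the exports' structural data (Haar measures, fundamental domain, covering weight, CM frame facts)
    (νG : Measure (quasiSplit (↥(maximalRealSubfield L)) L (IsCMField.complexConj L) 3).Adelic) [νG.IsHaarMeasure] [νG.IsInvInvariant] [SFinite νG]
    (ν : Measure ↥(adelicUnipotent (↥(maximalRealSubfield L)) L (IsCMField.complexConj L) 3)) [ν.IsHaarMeasure] [ν.IsMulRightInvariant] [ν.IsInvInvariant]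
    {𝓕 : Set ↥(adelicUnipotent (↥(maximalRealSubfield L)) L (IsCMField.complexConj L) 3)}
    (h𝓕N : IsFundamentalDomain ↥(rationalUnipotent (↥(maximalRealSubfield L)) L (IsCMField.complexConj L) 3) 𝓕 ν) (h𝓕c : IsCompact (closure 𝓕)) (h𝓕₀ : ν 𝓕 ≠ 0)
    {β : (quasiSplit (↥(maximalRealSubfield L)) L (IsCMField.complexConj L) 3).Adelic → ℝ≥0∞}
    (hβ : IsCoveringWeight ↥((arithmeticBorel (↥(maximalRealSubfield L)) L (IsCMField.complexConj L) 3).map (quasiSplit (↥(maximalRealSubfield L)) L (IsCMField.complexConj L) 3).arithmeticSubgroup.subtype) β)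
    {μZ : Measure (borelQuotient (↥(maximalRealSubfield L)) L (IsCMField.complexConj L) 3)} [SFinite μZ]
    (hμZ : ∀ f : borelQuotient (↥(maximalRealSubfield L)) L (IsCMField.complexConj L) 3 → ℝ≥0∞, Measurable f → ∫⁻ z, f z ∂μZ = ∫⁻ g, β g * f (toBorelQuotient (↥(maximalRealSubfield L)) L (IsCMField.complexConj L) 3 g) ∂νG)
    (μa : Measure (arch (↥(maximalRealSubfield L)) L (IsCMField.complexConj L) 3 ((StdForm.antidiagonal 3).over L))) [μa.IsHaarMeasure] [μa.IsMulRightInvariant]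
    (μf : Measure (finAdelic (↥(maximalRealSubfield L)) L (IsCMField.complexConj L) 3 ((StdForm.antidiagonal 3).over L))) [μf.IsHaarMeasure]
    (h2 : Module.finrank (↥(maximalRealSubfield L)) L = 2) (hc : IsCMField.complexConj L ≠ 1)
    -- (i) THE LEVEL OF RECORD `K(𝔫)` BY NAME, `𝔫 ≠ 0` (K2E1-p11 ★ p863976 ∕ p864091 ∕ p864141; `K_f := finCongruenceLevel 𝔫`, `U₀ := K_f(𝔫) ≤ GL₃(𝔸_f)` open compact ★ Ash–Smith): `K′ := levelOfRecord K(𝔫)_f`, `ω₀ := omegaOfRecord χ 1 K(𝔫)_f`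
    (𝔫 : Ideal (𝓞 L)) (h𝔫 : 𝔫 ≠ 0)
    -- (i) THE WITNESS AS BINDERS (J-S8-WIT′): `φ₀ ∈ V(ξ.bcη⁻¹·μω; levelOfRecord K_f, omegaOfRecord … 1 K_f)`, continuous, `‖φ₀‖ ≤ 1` (`Mφ := 1`)
    {φ₀ : (quasiSplit (↥(maximalRealSubfield L)) L (IsCMField.complexConj L) 3).Adelic → ℂ} (hφ₀V : φ₀ ∈ chiSectionSpace (ξ.bcη⁻¹ * μω) (levelOfRecord L (finCongruenceLevel (↥(maximalRealSubfield L)) L (IsCMField.complexConj L) 3 ((StdForm.antidiagonal 3).over L) 𝔫)) (omegaOfRecord L (ξ.bcη⁻¹ * μω) (1 : ↥(TorusDict.torus (IsCMField.complexConj L)) →ₜ* ℂˣ) (finCongruenceLevel (↥(maximalRealSubfield L)) L (IsCMField.complexConj L) 3 ((StdForm.antidiagonal 3).over L) 𝔫))) (hφ₀c : Continuous φ₀) (hφ₀M : ∀ x, ‖φ₀ x‖ ≤ 1)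
    {ι' : Type} [Fintype ι'] [DecidableEq ι'] (bV : Module.Basis ι' ℂ ↥(chiSectionSpace (reflectChar (IsCMField.complexConj L) (ξ.bcη⁻¹ * μω)) (levelOfRecord L (finCongruenceLevel (↥(maximalRealSubfield L)) L (IsCMField.complexConj L) 3 ((StdForm.antidiagonal 3).over L) 𝔫)) (omegaOfRecord L (ξ.bcη⁻¹ * μω) (1 : ↥(TorusDict.torus (IsCMField.complexConj L)) →ₜ* ℂˣ) (finCongruenceLevel (↥(maximalRealSubfield L)) L (IsCMField.complexConj L) 3 ((StdForm.antidiagonal 3).over L) 𝔫))))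
    (hbc : ∀ j, Continuous ((bV j : ↥(chiSectionSpace (reflectChar (IsCMField.complexConj L) (ξ.bcη⁻¹ * μω)) (levelOfRecord L (finCongruenceLevel (↥(maximalRealSubfield L)) L (IsCMField.complexConj L) 3 ((StdForm.antidiagonal 3).over L) 𝔫)) (omegaOfRecord L (ξ.bcη⁻¹ * μω) (1 : ↥(TorusDict.torus (IsCMField.complexConj L)) →ₜ* ℂˣ) (finCongruenceLevel (↥(maximalRealSubfield L)) L (IsCMField.complexConj L) 3 ((StdForm.antidiagonal 3).over L) 𝔫)))) : (quasiSplit (↥(maximalRealSubfield L)) L (IsCMField.complexConj L) 3).Adelic → ℂ)) {Mb : ℝ}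
    (hbM : ∀ j x, ‖((bV j : ↥(chiSectionSpace (reflectChar (IsCMField.complexConj L) (ξ.bcη⁻¹ * μω)) (levelOfRecord L (finCongruenceLevel (↥(maximalRealSubfield L)) L (IsCMField.complexConj L) 3 ((StdForm.antidiagonal 3).over L) 𝔫)) (omegaOfRecord L (ξ.bcη⁻¹ * μω) (1 : ↥(TorusDict.torus (IsCMField.complexConj L)) →ₜ* ℂˣ) (finCongruenceLevel (↥(maximalRealSubfield L)) L (IsCMField.complexConj L) 3 ((StdForm.antidiagonal 3).over L) 𝔫)))) : (quasiSplit (↥(maximalRealSubfield L)) L (IsCMField.complexConj L) 3).Adelic → ℂ) x‖ ≤ Mb)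
    -- (i) VISIBLE: THREE LETTERS about the NAMED UNTWISTED family `midWitnessEc` off the NAMED `midWitnessP` (★ `ledgerLetters_of_exports` turns them into ★ p864046's `hbddPK hbdd32` for `midWitnessEc·Θ`)
    (hE6 : ∀ T : ℝ≥0, 1 ≤ T → ∃ Fam : ℂ → (quasiSplit (↥(maximalRealSubfield L)) L (IsCMField.complexConj L) 3).L2 μ,
      ∀ z : ℂ, z ∉ midWitnessP L μ νG ν h𝓕N h𝓕c h𝓕₀ hβ hμZ hφ₀V hφ₀c hφ₀M (levelOfRecord_le L (finCongruenceLevel (↥(maximalRealSubfield L)) L (IsCMField.complexConj L) 3 ((StdForm.antidiagonal 3).over L) 𝔫)) (archToAdelic_mem_levelOfRecord L (finCongruenceLevel (↥(maximalRealSubfield L)) L (IsCMField.complexConj L) 3 ((StdForm.antidiagonal 3).over L) 𝔫)) ((principalCongruenceLevel 3 L 𝔫).comap (GLn.ofFinite 3 L)) (isOpen_comap_ofFinite_principalCongruenceLevel 3 L h𝔫) (isCompact_comap_ofFinite_principalCongruenceLevel 3 L h𝔫) (fun _ hb => exists_mem_levelOfRecord_omegaOfRecord_eq_one L (ξ.bcη⁻¹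 * μω) (1 : ↥(TorusDict.torus (IsCMField.complexConj L)) →ₜ* ℂˣ) (finCongruenceLevel_le_integralLevel (↥(maximalRealSubfield L)) L (IsCMField.complexConj L) 3 ((StdForm.antidiagonal 3).over L) 𝔫) hb) (fun _ hφ => continuous_of_mem_chiSectionSpace_levelOfRecord L (ξ.bcη⁻¹ * μω) (finCongruenceLevel_le_integralLevel (↥(maximalRealSubfield L)) L (IsCMField.complexConj L) 3 ((StdForm.antidiagonal 3).over L) 𝔫) (isOpen_finCongruenceLevel (↥(maximalRealSubfield L)) L (IsCMField.complexConj L) 3 ((StdForm.antidiagonal 3).over L) h𝔫) hφ) μa μf bV hbc hbM h2 hc (antidiagonal_over_det_ne_zero L 3) ξ.ψ ξ.hψ → ((Fam z : (quasiSplit (↥(maximalRealSubfield L)) L (IsCMField.complexConj L) 3).L2 μ) : (quasiSplit (↥(maximalRealSubfield L)) L (IsCMField.complexConj L) 3).automorphicQuotient → ℂ) =ᵐ[μ] (quasiSplit (↥(maximalRealSubfield L)) L (IsCMField.complexConj L) 3).quotFun (truncation ν 𝓕 T (midWitnessEc L μ νG ν h𝓕N h𝓕c h𝓕₀ hβ hμZ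 hφ₀V hφ₀c hφ₀M (levelOfRecord_le L (finCongruenceLevel (↥(maximalRealSubfield L)) L (IsCMField.complexConj L) 3 ((StdForm.antidiagonal 3).over L) 𝔫)) (archToAdelic_mem_levelOfRecord L (finCongruenceLevel (↥(maximalRealSubfield L)) L (IsCMField.complexConj L) 3 ((StdForm.antidiagonal 3).over L) 𝔫)) ((principalCongruenceLevel 3 L 𝔫).comap (GLn.ofFinite 3 L)) (isOpen_comap_ofFinite_principalCongruenceLevel 3 L h𝔫) (isCompact_comap_ofFinite_principalCongruenceLevel 3 L h𝔫) (fun _ hb => exists_mem_levelOfRecord_omegaOfRecord_eq_one L (ξ.bcη⁻¹ * μω) (1 : ↥(TorusDict.torus (IsCMField.complexConj L)) →ₜ* ℂˣ) (finCongruenceLevel_le_integralLevel (↥(maximalRealSubfield L)) L (IsCMField.complexConj L) 3 ((StdForm.antidiagonal 3).over L) 𝔫) hb) (fun _ hφ => continuous_of_mem_chiSectionSpace_levelOfRecord L (ξ.bcη⁻¹ * μω) (finCongruenceLevel_le_integralLevel (↥(maximalRealSubfield L)) L (IsCMField.complexConj L) 3 ((StdForm.antidiagonal 3).over L) 𝔫)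 (isOpen_finCongruenceLevel (↥(maximalRealSubfield L)) L (IsCMField.complexConj L) 3 ((StdForm.antidiagonal 3).over L) h𝔫) hφ) μa μf bV hbc hbM h2 hc (antidiagonal_over_det_ne_zero L 3) ξ.ψ ξ.hψ z)))
    (hMSP' : ∀ z₀ ∈ midWitnessP L μ νG ν h𝓕N h𝓕c h𝓕₀ hβ hμZ hφ₀V hφ₀c hφ₀M (levelOfRecord_le L (finCongruenceLevel (↥(maximalRealSubfield L)) L (IsCMField.complexConj L) 3 ((StdForm.antidiagonal 3).over L) 𝔫)) (archToAdelic_mem_levelOfRecord L (finCongruenceLevel (↥(maximalRealSubfield L)) L (IsCMField.complexConj L) 3 ((StdForm.antidiagonal 3).over L) 𝔫)) ((principalCongruenceLevel 3 L 𝔫).comap (GLn.ofFinite 3 L)) (isOpen_comap_ofFinite_principalCongruenceLevel 3 L h𝔫) (isCompact_comap_ofFinite_principalCongruenceLevel 3 L h𝔫) (fun _ hb => exists_mem_levelOfRecord_omegaOfRecord_eq_one L (ξ.bcη⁻¹ * μω) (1 : ↥(TorusDict.torus (IsCMField.complexConj L)) →ₜ* ℂˣ) (finCongruenceLevel_le_integralLevel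 (↥(maximalRealSubfield L)) L (IsCMField.complexConj L) 3 ((StdForm.antidiagonal 3).over L) 𝔫) hb) (fun _ hφ => continuous_of_mem_chiSectionSpace_levelOfRecord L (ξ.bcη⁻¹ * μω) (finCongruenceLevel_le_integralLevel (↥(maximalRealSubfield L)) L (IsCMField.complexConj L) 3 ((StdForm.antidiagonal 3).over L) 𝔫) (isOpen_finCongruenceLevel (↥(maximalRealSubfield L)) L (IsCMField.complexConj L) 3 ((StdForm.antidiagonal 3).over L) h𝔫) hφ) μa μf bV hbc hbM h2 hc (antidiagonal_over_det_ne_zero L 3) ξ.ψ ξ.hψ, 1 < z₀.re → z₀ ≠ (3 : ℂ) / 2 → ∀ T : ℝ≥0, 1 ≤ T →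
      ∃ Fam : ℂ → (quasiSplit (↥(maximalRealSubfield L)) L (IsCMField.complexConj L) 3).L2 μ,
        (∀ z : ℂ, z ∉ midWitnessP L μ νG ν h𝓕N h𝓕c h𝓕₀ hβ hμZ hφ₀V hφ₀c hφ₀M (levelOfRecord_le L (finCongruenceLevel (↥(maximalRealSubfield L)) L (IsCMField.complexConj L) 3 ((StdForm.antidiagonal 3).over L) 𝔫)) (archToAdelic_mem_levelOfRecord L (finCongruenceLevel (↥(maximalRealSubfield L)) L (IsCMField.complexConj L) 3 ((StdForm.antidiagonal 3).over L) 𝔫)) ((principalCongruenceLevel 3 L 𝔫).comap (GLn.ofFinite 3 L)) (isOpen_comap_ofFinite_principalCongruenceLevel 3 L h𝔫) (isCompact_comap_ofFinite_principalCongruenceLevel 3 L h𝔫) (fun _ hb => exists_mem_levelOfRecord_omegaOfRecord_eq_one L (ξ.bcη⁻¹ * μω) (1 : ↥(TorusDict.torus (IsCMField.complexConj L)) →ₜ* ℂˣ) (finCongruenceLevel_le_integralLevel (↥(maximalRealSubfield L)) L (IsCMField.complexConj L) 3 ((StdForm.antidiagonal 3).over L) 𝔫) hb) (fun _ hφ =>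 continuous_of_mem_chiSectionSpace_levelOfRecord L (ξ.bcη⁻¹ * μω) (finCongruenceLevel_le_integralLevel (↥(maximalRealSubfield L)) L (IsCMField.complexConj L) 3 ((StdForm.antidiagonal 3).over L) 𝔫) (isOpen_finCongruenceLevel (↥(maximalRealSubfield L)) L (IsCMField.complexConj L) 3 ((StdForm.antidiagonal 3).over L) h𝔫) hφ) μa μf bV hbc hbM h2 hc (antidiagonal_over_det_ne_zero L 3) ξ.ψ ξ.hψ → ((Fam z : (quasiSplit (↥(maximalRealSubfield L)) L (IsCMField.complexConj L) 3).L2 μ) : (quasiSplit (↥(maximalRealSubfield L)) L (IsCMField.complexConj L) 3).automorphicQuotient → ℂ) =ᵐ[μ] (quasiSplit (↥(maximalRealSubfield L)) L (IsCMField.complexConj L) 3).quotFun (truncation ν 𝓕 T (midWitnessEc L μ νG ν h𝓕N h𝓕c h𝓕₀ hβ hμZ hφ₀V hφ₀c hφ₀M (levelOfRecord_le L (finCongruenceLevel (↥(maximalRealSubfield L)) L (IsCMField.complexConj L) 3 ((StdForm.antidiagonal 3).over L) 𝔫)) (archToAdelic_mem_levelOfRecord L (finCongruenceLevel (↥(maximalRealSubfield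 L)) L (IsCMField.complexConj L) 3 ((StdForm.antidiagonal 3).over L) 𝔫)) ((principalCongruenceLevel 3 L 𝔫).comap (GLn.ofFinite 3 L)) (isOpen_comap_ofFinite_principalCongruenceLevel 3 L h𝔫) (isCompact_comap_ofFinite_principalCongruenceLevel 3 L h𝔫) (fun _ hb => exists_mem_levelOfRecord_omegaOfRecord_eq_one L (ξ.bcη⁻¹ * μω) (1 : ↥(TorusDict.torus (IsCMField.complexConj L)) →ₜ* ℂˣ) (finCongruenceLevel_le_integralLevel (↥(maximalRealSubfield L)) L (IsCMField.complexConj L) 3 ((StdForm.antidiagonal 3).over L) 𝔫) hb) (fun _ hφ => continuous_of_mem_chiSectionSpace_levelOfRecord L (ξ.bcη⁻¹ * μω) (finCongruenceLevel_le_integralLevel (↥(maximalRealSubfield L)) L (IsCMField.complexConj L) 3 ((StdForm.antidiagonal 3).over L) 𝔫) (isOpen_finCongruenceLevel (↥(maximalRealSubfield L)) L (IsCMField.complexConj L) 3 ((StdForm.antidiagonal 3).over L) h𝔫) hφ) μa μf bV hbc hbM h2 hc (antidiagonal_over_det_ne_zero L 3) ξ.ψ ξ.hψ z))) ∧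
        ∃ C : ℝ, ∀ᶠ z in 𝓝[≠] z₀, ‖Fam z‖ ≤ C)
    (hMS32 : ∀ T : ℝ≥0, 1 ≤ T →
      ∃ C : ℝ, ∀ᶠ z in 𝓝[≠] ((3 : ℂ) / 2), ‖z - (3 : ℂ) / 2‖ * (eLpNorm ((quasiSplit (↥(maximalRealSubfield L)) L (IsCMField.complexConj L) 3).quotFun (truncation ν 𝓕 T (midWitnessEc L μ νG ν h𝓕N h𝓕c h𝓕₀ hβ hμZ hφ₀V hφ₀c hφ₀M (levelOfRecord_le L (finCongruenceLevel (↥(maximalRealSubfield L)) L (IsCMField.complexConj L) 3 ((StdForm.antidiagonal 3).over L) 𝔫)) (archToAdelic_mem_levelOfRecord L (finCongruenceLevel (↥(maximalRealSubfield L)) L (IsCMField.complexConj L) 3 ((StdForm.antidiagonal 3).over L) 𝔫)) ((principalCongruenceLevel 3 L 𝔫).comap (GLn.ofFinite 3 L)) (isOpen_comap_ofFinite_principalCongruenceLevel 3 L h𝔫) (isCompact_comap_ofFinite_principalCongruenceLevel 3 L h𝔫) (fun _ hb => exists_mem_levelOfRecord_omegaOfRecord_eq_one L (ξ.bcη⁻¹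 * μω) (1 : ↥(TorusDict.torus (IsCMField.complexConj L)) →ₜ* ℂˣ) (finCongruenceLevel_le_integralLevel (↥(maximalRealSubfield L)) L (IsCMField.complexConj L) 3 ((StdForm.antidiagonal 3).over L) 𝔫) hb) (fun _ hφ => continuous_of_mem_chiSectionSpace_levelOfRecord L (ξ.bcη⁻¹ * μω) (finCongruenceLevel_le_integralLevel (↥(maximalRealSubfield L)) L (IsCMField.complexConj L) 3 ((StdForm.antidiagonal 3).over L) 𝔫) (isOpen_finCongruenceLevel (↥(maximalRealSubfield L)) L (IsCMField.complexConj L) 3 ((StdForm.antidiagonal 3).over L) h𝔫) hφ) μa μf bV hbc hbM h2 hc (antidiagonal_over_det_ne_zero L 3) ξ.ψ ξ.hψ z))) 2 μ).toReal ≤ C)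
    -- (ii) ★ p864046's row (ii) VERBATIM (the named family at the level of record)
    (ψ φt : ℂ → (quasiSplit (↥(maximalRealSubfield L)) L (IsCMField.complexConj L) 3).Adelic → ℂ)
    (hE3 : ∀ z ∈ (({z : ℂ | 1 < z.re} \ (↑({(3 : ℂ) / 2} : Finset ℂ) : Set ℂ)) ∩ (midWitnessP L μ νG ν h𝓕N h𝓕c h𝓕₀ hβ hμZ hφ₀V hφ₀c hφ₀M (levelOfRecord_le L (finCongruenceLevel (↥(maximalRealSubfield L)) L (IsCMField.complexConj L) 3 ((StdForm.antidiagonal 3).over L) 𝔫)) (archToAdelic_mem_levelOfRecord L (finCongruenceLevel (↥(maximalRealSubfield L)) L (IsCMField.complexConj L) 3 ((StdForm.antidiagonal 3).over L) 𝔫)) ((principalCongruenceLevel 3 L 𝔫).comap (GLn.ofFinite 3 L)) (isOpen_comap_ofFinite_principalCongruenceLevel 3 L h𝔫) (isCompact_comap_ofFinite_principalCongruenceLevel 3 L h𝔫) (fun _ hb => exists_mem_levelOfRecord_omegaOfRecord_eq_one L (ξ.bcη⁻¹ * μω) (1 : ↥(TorusDict.torus (IsCMField.complexConj L)) →ₜ*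 ℂˣ) (finCongruenceLevel_le_integralLevel (↥(maximalRealSubfield L)) L (IsCMField.complexConj L) 3 ((StdForm.antidiagonal 3).over L) 𝔫) hb) (fun _ hφ => continuous_of_mem_chiSectionSpace_levelOfRecord L (ξ.bcη⁻¹ * μω) (finCongruenceLevel_le_integralLevel (↥(maximalRealSubfield L)) L (IsCMField.complexConj L) 3 ((StdForm.antidiagonal 3).over L) 𝔫) (isOpen_finCongruenceLevel (↥(maximalRealSubfield L)) L (IsCMField.complexConj L) 3 ((StdForm.antidiagonal 3).over L) h𝔫) hφ) μa μf bV hbc hbM h2 hc (antidiagonal_over_det_ne_zero L 3) ξ.ψ ξ.hψ)ᶜ), ∀ g : (quasiSplit (↥(maximalRealSubfield L)) L (IsCMField.complexConj L) 3).Adelic,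
      borelConstantTerm ν 𝓕 (fun x => midWitnessEc L μ νG ν h𝓕N h𝓕c h𝓕₀ hβ hμZ hφ₀V hφ₀c hφ₀M (levelOfRecord_le L (finCongruenceLevel (↥(maximalRealSubfield L)) L (IsCMField.complexConj L) 3 ((StdForm.antidiagonal 3).over L) 𝔫)) (archToAdelic_mem_levelOfRecord L (finCongruenceLevel (↥(maximalRealSubfield L)) L (IsCMField.complexConj L) 3 ((StdForm.antidiagonal 3).over L) 𝔫)) ((principalCongruenceLevel 3 L 𝔫).comap (GLn.ofFinite 3 L)) (isOpen_comap_ofFinite_principalCongruenceLevel 3 L h𝔫) (isCompact_comap_ofFinite_principalCongruenceLevel 3 L h𝔫) (fun _ hb => exists_mem_levelOfRecord_omegaOfRecord_eq_one L (ξ.bcη⁻¹ * μω) (1 : ↥(TorusDict.torus (IsCMField.complexConj L)) →ₜ* ℂˣ) (finCongruenceLevel_le_integralLevel (↥(maximalRealSubfield L)) L (IsCMField.complexConj L) 3 ((StdForm.antidiagonal 3).over L) 𝔫) hb) (fun _ hφ => continuous_of_mem_chiSectionSpace_levelOfRecord L (ξ.bcη⁻¹ * μω) (finCongruenceLevel_le_integralLevel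 (↥(maximalRealSubfield L)) L (IsCMField.complexConj L) 3 ((StdForm.antidiagonal 3).over L) 𝔫) (isOpen_finCongruenceLevel (↥(maximalRealSubfield L)) L (IsCMField.complexConj L) 3 ((StdForm.antidiagonal 3).over L) h𝔫) hφ) μa μf bV hbc hbM h2 hc (antidiagonal_over_det_ne_zero L 3) ξ.ψ ξ.hψ z x * ((detChar (↥(maximalRealSubfield L)) L (IsCMField.complexConj L) h2 hc 3 ((StdForm.antidiagonal 3).over L) ξ.ψ ξ.hψ (antidiagonal_over_det_ne_zero L 3) x : ℂˣ) : ℂ)) g = (fun x => φ₀ x * ((detChar (↥(maximalRealSubfield L)) L (IsCMField.complexConj L) h2 hc 3 ((StdForm.antidiagonal 3).over L) ξ.ψ ξ.hψ (antidiagonal_over_det_ne_zero L 3) x : ℂˣ) : ℂ)) g * (((borelHeight g : ℝ≥0) : ℝ) : ℂ) ^ z + ψ z g * (((borelHeight g : ℝ≥0) : ℝ) : ℂ) ^ (2 - z))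
    (q qc : ℂ → ℂ) {P : Set ℂ} (hqcq : ∀ z : ℂ, 2 < z.re → qc z = q z) (hPcd : ∀ z₀ : ℂ, ∀ᶠ s in 𝓝[≠] z₀, s ∉ P) (hqa : ∀ z : ℂ, z ∉ P → AnalyticAt ℂ qc z)
    (hfac : ∀ᶠ z in 𝓝[≠] ((3 : ℂ) / 2), ∀ g, ψ z g = qc z * φt z g) (hφt : ∀ g, ContinuousAt (fun z => φt z g) ((3 : ℂ) / 2))
    {g₀ : (quasiSplit (↥(maximalRealSubfield L)) L (IsCMField.complexConj L) 3).Adelic} (hg₀ : φt ((3 : ℂ) / 2) g₀ ≠ 0) {Cφt : ℝ} (hφtbd : ∀ g, ‖φt ((3 : ℂ) / 2) g‖ ≤ Cφt)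
    -- (iii) ★ p864046's row (iii): the ramification data VERBATIM, then the NAMED `A` (below)
    {S : Set (HeightOneSpectrum (𝓞 L))} {T' : Set (HeightOneSpectrum (𝓞 ↥(maximalRealSubfield L)))}
    (hS : S.Finite) (hurφ : ∀ w ∉ S, (ξ.bcη⁻¹ * μω).IsUnramifiedAt w) (hT' : T'.Finite) (hurη : ∀ v ∉ T', (1 : HeckeCharacter ↥(maximalRealSubfield L)).IsUnramifiedAt v)
    -- (iii) `A` FULLY NAMED AT THE MID-BLOCK TABLE `m_w = kμ,w − 2·ξ.eη w` (★ p864366 + K2E1-p13's ★ `shiftExponents_spec`; visible: the parity `hk` of `kμ`): `A z := (C·∏_{v∈S₀} ν_v(𝒪_v³)⁻¹ • ∫ 𝟙_{B_v(𝔫)}·Q_v^{−z}) · ∫∫ (∏_w ε_w·archUnitaryValue m_w 0 ζ_w·((2+ζ_w)∕ζ_w)^{p_w}·((2+conj ζ_w)∕conj ζ_w)^{q_w})·ARCH₃^{−z}`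
    {δ : L} (hcδ : IsCMField.complexConj L δ = -δ) (hδ : δ ≠ 0)
    [∀ v : HeightOneSpectrum (𝓞 ↥(maximalRealSubfield L)), MeasurableSpace (v.adicCompletion ↥(maximalRealSubfield L))] [∀ v : HeightOneSpectrum (𝓞 ↥(maximalRealSubfield L)), BorelSpace (v.adicCompletion ↥(maximalRealSubfield L))]
    (νv : ∀ v : HeightOneSpectrum (𝓞 ↥(maximalRealSubfield L)), Measure (v.adicCompletion ↥(maximalRealSubfield L))) [∀ v, (νv v).IsAddHaarMeasure]
    [MeasurableSpace (InfiniteAdeleRing L)] [BorelSpace (InfiniteAdeleRing L)]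
    [MeasurableSpace (InfiniteAdeleRing ↥(maximalRealSubfield L))] [BorelSpace (InfiniteAdeleRing ↥(maximalRealSubfield L))]
    (μE₁ : Measure (InfiniteAdeleRing L)) [μE₁.IsAddHaarMeasure] (μF₁ : Measure (InfiniteAdeleRing ↥(maximalRealSubfield L))) [μF₁.IsAddHaarMeasure]
    (ε : InfinitePlace L → ℂ) (hε1 : ∀ w, ‖ε w‖ ≤ 1) (hε0 : ∀ w, ε w ≠ 0)
    (kμ : InfinitePlace L → ℤ) (hk : ∀ w, Int.ModEq 2 (kμ w) 1)
    (S₀ : Finset (HeightOneSpectrum (𝓞 ↥(maximalRealSubfield L)))) {C : ℂ} (hC : C ≠ 0)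
    (hA : DifferentiableOn ℂ (fun z : ℂ => (C * ∏ v ∈ S₀, ((Measure.pi fun _ : Fin 3 => νv v) (integralBox ↥(maximalRealSubfield L) (Fin 3) v)).toReal⁻¹ •
              ∫ p : Fin 3 → v.adicCompletion ↥(maximalRealSubfield L),
                Set.indicator {p : Fin 3 → v.adicCompletion ↥(maximalRealSubfield L) | p ∈ integralBox ↥(maximalRealSubfield L) (Fin 3) v ∧ ∀ w' : PlacesOver L v,
                    Valued.v (quadraticLocalEquiv L v (IsCMField.complexConj L) hcδ hδ (p 0, p 1) w') ≤ idealRadius L w'.1 𝔫 ∧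
                    Valued.v (conjLocal L (IsCMField.complexConj L) v (quadraticLocalEquiv L v (IsCMField.complexConj L) hcδ hδ (p 0, p 1)) w') ≤ idealRadius L w'.1 𝔫 ∧
                    Valued.v ((toLocalRing L v (p 2) * algebraMap L (LocalRing L v) δ -
                      toLocalRing L v 2⁻¹ * (quadraticLocalEquiv L v (IsCMField.complexConj L) hcδ hδ (p 0, p 1) * conjLocal L (IsCMField.complexConj L) v (quadraticLocalEquiv L v (IsCMField.complexConj L) hcδ hδ (p 0, p 1)))) w') ≤ idealRadius L w'.1 𝔫}
                  (fun _ => (1 : ℂ)) p *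
                (((∏ w' : PlacesOver L v, max 1 (max ((normAbs (w'.1.adicCompletion L) (quadraticLocalEquiv L v (IsCMField.complexConj L) hcδ hδ (p 0, p 1) w') : ℝ≥0) : ℝ)
                  ((normAbs (w'.1.adicCompletion L) ((toLocalRing L v (p 2) * algebraMap L (LocalRing L v) δ -
                    toLocalRing L v 2⁻¹ * (quadraticLocalEquiv L v (IsCMField.complexConj L) hcδ hδ (p 0, p 1) *
                      conjLocal L (IsCMField.complexConj L) v (quadraticLocalEquiv L v (IsCMField.complexConj L) hcδ hδ (p 0, p 1)))) w') : ℝ≥0) : ℝ))) : ℝ) : ℂ) ^ (-z) ∂(Measure.pi fun _ : Fin 3 => νv v)) *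
            ∫ Xi : InfiniteAdeleRing L, ∫ a : InfiniteAdeleRing ↥(maximalRealSubfield L),
            (∏ w : InfinitePlace L, ε w * archUnitaryValue (kμ w - 2 * ξ.eη w) 0 ((((-(1 + ‖Xi w‖ ^ 2 / 2)) : ℝ) : ℂ) + (((w.embedding δ).im * ((InfiniteAdeleRing.ringEquiv_mixedSpace ↥(maximalRealSubfield L)) a).1 ⟨w.comap (algebraMap ↥(maximalRealSubfield L) L), Summit.HodgeConjecture.HodgeConjecture.Cruxes.H413.K2E1HeightBigCellLineFormulaU2.isReal_comap_maximalRealSubfield L w⟩ : ℝ) : ℂ) * Complex.I) * (((2 : ℂ) + ((((-(1 + ‖Xi w‖ ^ 2 / 2)) : ℝ) : ℂ) + (((w.embedding δ).im * ((InfiniteAdeleRing.ringEquiv_mixedSpace ↥(maximalRealSubfield L)) a).1 ⟨w.comap (algebraMap ↥(maximalRealSubfield L) L), Summit.HodgeConjecture.HodgeConjecture.Cruxes.H413.K2E1HeightBigCellLineFormulaU2.isReal_comap_maximalRealSubfield L w⟩ : ℝ) : ℂ) * Complex.I)) / ((((-(1 + ‖Xi w‖ ^ 2 / 2)) : ℝ)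 : ℂ) + (((w.embedding δ).im * ((InfiniteAdeleRing.ringEquiv_mixedSpace ↥(maximalRealSubfield L)) a).1 ⟨w.comap (algebraMap ↥(maximalRealSubfield L) L), Summit.HodgeConjecture.HodgeConjecture.Cruxes.H413.K2E1HeightBigCellLineFormulaU2.isReal_comap_maximalRealSubfield L w⟩ : ℝ) : ℂ) * Complex.I)) ^ (((kμ w - 2 * ξ.eη w) - 1) / 2).toNat * (((2 : ℂ) + conj ((((-(1 + ‖Xi w‖ ^ 2 / 2)) : ℝ) : ℂ) + (((w.embedding δ).im * ((InfiniteAdeleRing.ringEquiv_mixedSpace ↥(maximalRealSubfield L)) a).1 ⟨w.comap (algebraMap ↥(maximalRealSubfield L) L), Summit.HodgeConjecture.HodgeConjecture.Cruxes.H413.K2E1HeightBigCellLineFormulaU2.isReal_comap_maximalRealSubfield L w⟩ : ℝ) : ℂ) * Complex.I)) / conj ((((-(1 + ‖Xi w‖ ^ 2 / 2)) : ℝ) : ℂ) + (((w.embedding δ).im * ((InfiniteAdeleRing.ringEquiv_mixedSpace ↥(maximalRealSubfield L)) a).1 ⟨w.comap (algebraMap ↥(maximalRealSubfield L) L), Summit.HodgeConjecture.HodgeConjecture.Cruxes.H413.K2E1HeightBigCellLineFormulaU2.isReal_comap_maximalRealSubfield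 L w⟩ : ℝ) : ℂ) * Complex.I)) ^ ((-(kμ w - 2 * ξ.eη w) - 1) / 2).toNat) *
              ((((∏ w : InfinitePlace L, ((1 + ‖(Xi) w‖ ^ 2 / 2) ^ 2 + (w δ) ^ 2 * (((InfiniteAdeleRing.ringEquiv_mixedSpace ↥(maximalRealSubfield L)) a).1 ⟨w.comap (algebraMap ↥(maximalRealSubfield L) L), Summit.HodgeConjecture.HodgeConjecture.Cruxes.H413.K2E1HeightBigCellLineFormulaU2.isReal_comap_maximalRealSubfield L w⟩) ^ 2))) : ℝ) : ℂ) ^ (-z) ∂μF₁ ∂μE₁) {z : ℂ | 1 < z.re})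
    (hsrc : ∀ z : ℂ, 2 < z.re → q z = (fun z : ℂ => (C * ∏ v ∈ S₀, ((Measure.pi fun _ : Fin 3 => νv v) (integralBox ↥(maximalRealSubfield L) (Fin 3) v)).toReal⁻¹ •
              ∫ p : Fin 3 → v.adicCompletion ↥(maximalRealSubfield L),
                Set.indicator {p : Fin 3 → v.adicCompletion ↥(maximalRealSubfield L) | p ∈ integralBox ↥(maximalRealSubfield L) (Fin 3) v ∧ ∀ w' : PlacesOver L v,
                    Valued.v (quadraticLocalEquiv L v (IsCMField.complexConj L) hcδ hδ (p 0, p 1) w') ≤ idealRadius L w'.1 𝔫 ∧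
                    Valued.v (conjLocal L (IsCMField.complexConj L) v (quadraticLocalEquiv L v (IsCMField.complexConj L) hcδ hδ (p 0, p 1)) w') ≤ idealRadius L w'.1 𝔫 ∧
                    Valued.v ((toLocalRing L v (p 2) * algebraMap L (LocalRing L v) δ -
                      toLocalRing L v 2⁻¹ * (quadraticLocalEquiv L v (IsCMField.complexConj L) hcδ hδ (p 0, p 1) * conjLocal L (IsCMField.complexConj L) v (quadraticLocalEquiv L v (IsCMField.complexConj L) hcδ hδ (p 0, p 1)))) w') ≤ idealRadius L w'.1 𝔫}
                  (fun _ => (1 : ℂ)) p *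
                (((∏ w' : PlacesOver L v, max 1 (max ((normAbs (w'.1.adicCompletion L) (quadraticLocalEquiv L v (IsCMField.complexConj L) hcδ hδ (p 0, p 1) w') : ℝ≥0) : ℝ)
                  ((normAbs (w'.1.adicCompletion L) ((toLocalRing L v (p 2) * algebraMap L (LocalRing L v) δ -
                    toLocalRing L v 2⁻¹ * (quadraticLocalEquiv L v (IsCMField.complexConj L) hcδ hδ (p 0, p 1) *
                      conjLocal L (IsCMField.complexConj L) v (quadraticLocalEquiv L v (IsCMField.complexConj L) hcδ hδ (p 0, p 1)))) w') : ℝ≥0) : ℝ))) : ℝ) : ℂ) ^ (-z) ∂(Measure.pi fun _ : Fin 3 => νv v)) *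
            ∫ Xi : InfiniteAdeleRing L, ∫ a : InfiniteAdeleRing ↥(maximalRealSubfield L),
            (∏ w : InfinitePlace L, ε w * archUnitaryValue (kμ w - 2 * ξ.eη w) 0 ((((-(1 + ‖Xi w‖ ^ 2 / 2)) : ℝ) : ℂ) + (((w.embedding δ).im * ((InfiniteAdeleRing.ringEquiv_mixedSpace ↥(maximalRealSubfield L)) a).1 ⟨w.comap (algebraMap ↥(maximalRealSubfield L) L), Summit.HodgeConjecture.HodgeConjecture.Cruxes.H413.K2E1HeightBigCellLineFormulaU2.isReal_comap_maximalRealSubfield L w⟩ : ℝ) : ℂ) * Complex.I) * (((2 : ℂ) + ((((-(1 + ‖Xi w‖ ^ 2 / 2)) : ℝ) : ℂ) + (((w.embedding δ).im * ((InfiniteAdeleRing.ringEquiv_mixedSpace ↥(maximalRealSubfield L)) a).1 ⟨w.comap (algebraMap ↥(maximalRealSubfield L) L), Summit.HodgeConjecture.HodgeConjecture.Cruxes.H413.K2E1HeightBigCellLineFormulaU2.isReal_comap_maximalRealSubfield L w⟩ : ℝ) : ℂ) * Complex.I)) / ((((-(1 + ‖Xi w‖ ^ 2 / 2)) : ℝ)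 : ℂ) + (((w.embedding δ).im * ((InfiniteAdeleRing.ringEquiv_mixedSpace ↥(maximalRealSubfield L)) a).1 ⟨w.comap (algebraMap ↥(maximalRealSubfield L) L), Summit.HodgeConjecture.HodgeConjecture.Cruxes.H413.K2E1HeightBigCellLineFormulaU2.isReal_comap_maximalRealSubfield L w⟩ : ℝ) : ℂ) * Complex.I)) ^ (((kμ w - 2 * ξ.eη w) - 1) / 2).toNat * (((2 : ℂ) + conj ((((-(1 + ‖Xi w‖ ^ 2 / 2)) : ℝ) : ℂ) + (((w.embedding δ).im * ((InfiniteAdeleRing.ringEquiv_mixedSpace ↥(maximalRealSubfield L)) a).1 ⟨w.comap (algebraMap ↥(maximalRealSubfield L) L), Summit.HodgeConjecture.HodgeConjecture.Cruxes.H413.K2E1HeightBigCellLineFormulaU2.isReal_comap_maximalRealSubfield L w⟩ : ℝ) : ℂ) * Complex.I)) / conj ((((-(1 + ‖Xi w‖ ^ 2 / 2)) : ℝ) : ℂ) + (((w.embedding δ).im * ((InfiniteAdeleRing.ringEquiv_mixedSpace ↥(maximalRealSubfield L)) a).1 ⟨w.comap (algebraMap ↥(maximalRealSubfield L) L), Summit.HodgeConjecture.HodgeConjecture.Cruxes.H413.K2E1HeightBigCellLineFormulaU2.isReal_comap_maximalRealSubfield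 L w⟩ : ℝ) : ℂ) * Complex.I)) ^ ((-(kμ w - 2 * ξ.eη w) - 1) / 2).toNat) *
              ((((∏ w : InfinitePlace L, ((1 + ‖(Xi) w‖ ^ 2 / 2) ^ 2 + (w δ) ^ 2 * (((InfiniteAdeleRing.ringEquiv_mixedSpace ↥(maximalRealSubfield L)) a).1 ⟨w.comap (algebraMap ↥(maximalRealSubfield L) L), Summit.HodgeConjecture.HodgeConjecture.Cruxes.H413.K2E1HeightBigCellLineFormulaU2.isReal_comap_maximalRealSubfield L w⟩) ^ 2))) : ℝ) : ℂ) ^ (-z) ∂μF₁ ∂μE₁) z *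
          ((partialStandardL S (fun w => {(ξ.bcη⁻¹ * μω).valueAtUniformizer w}) (z - 1) * partialStandardL T' (fun v => {(1 : HeckeCharacter ↥(maximalRealSubfield L)).valueAtUniformizer v}) (2 * z - 2)) /
            (partialStandardL S (fun w => {(ξ.bcη⁻¹ * μω).valueAtUniformizer w}) z * partialStandardL T' (fun v => {(1 : HeckeCharacter ↥(maximalRealSubfield L)).valueAtUniformizer v}) (2 * z - 1))))
    -- (i′) ★ p864046's row (i′) VERBATIM (the named family at the level of record)
    {T : ℝ≥0} (hT : 1 ≤ T) (Fam : ℂ → (quasiSplit (↥(maximalRealSubfield L)) L (IsCMField.complexConj L) 3).L2 μ) (hFd : DifferentiableOn ℂ Fam (({z : ℂ | 1 < z.re} \ (↑({(3 : ℂ) / 2} : Finset ℂ) : Set ℂ)) ∩ (midWitnessP L μ νG ν h𝓕N h𝓕c h𝓕₀ hβ hμZ hφ₀V hφ₀c hφ₀M (levelOfRecord_le L (finCongruenceLevel (↥(maximalRealSubfield L)) L (IsCMField.complexConj L) 3 ((StdForm.antidiagonal 3).over L) 𝔫)) (archToAdelic_mem_levelOfRecord L (finCongruenceLevel (↥(maximalRealSubfield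 L)) L (IsCMField.complexConj L) 3 ((StdForm.antidiagonal 3).over L) 𝔫)) ((principalCongruenceLevel 3 L 𝔫).comap (GLn.ofFinite 3 L)) (isOpen_comap_ofFinite_principalCongruenceLevel 3 L h𝔫) (isCompact_comap_ofFinite_principalCongruenceLevel 3 L h𝔫) (fun _ hb => exists_mem_levelOfRecord_omegaOfRecord_eq_one L (ξ.bcη⁻¹ * μω) (1 : ↥(TorusDict.torus (IsCMField.complexConj L)) →ₜ* ℂˣ) (finCongruenceLevel_le_integralLevel (↥(maximalRealSubfield L)) L (IsCMField.complexConj L) 3 ((StdForm.antidiagonal 3).over L) 𝔫) hb) (fun _ hφ => continuous_of_mem_chiSectionSpace_levelOfRecord L (ξ.bcη⁻¹ * μω) (finCongruenceLevel_le_integralLevel (↥(maximalRealSubfield L)) L (IsCMField.complexConj L) 3 ((StdForm.antidiagonal 3).over L) 𝔫) (isOpen_finCongruenceLevel (↥(maximalRealSubfield L)) L (IsCMField.complexConj L) 3 ((StdForm.antidiagonal 3).over L) h𝔫) hφ) μa μf bV hbc hbM h2 hc (antidiagonal_over_det_ne_zero L 3) ξ.ψ ξ.hψ)ᶜ))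
    (hFam : ∀ z ∈ (({z : ℂ | 1 < z.re} \ (↑({(3 : ℂ) / 2} : Finset ℂ) : Set ℂ)) ∩ (midWitnessP L μ νG ν h𝓕N h𝓕c h𝓕₀ hβ hμZ hφ₀V hφ₀c hφ₀M (levelOfRecord_le L (finCongruenceLevel (↥(maximalRealSubfield L)) L (IsCMField.complexConj L) 3 ((StdForm.antidiagonal 3).over L) 𝔫)) (archToAdelic_mem_levelOfRecord L (finCongruenceLevel (↥(maximalRealSubfield L)) L (IsCMField.complexConj L) 3 ((StdForm.antidiagonal 3).over L) 𝔫)) ((principalCongruenceLevel 3 L 𝔫).comap (GLn.ofFinite 3 L)) (isOpen_comap_ofFinite_principalCongruenceLevel 3 L h𝔫) (isCompact_comap_ofFinite_principalCongruenceLevel 3 L h𝔫) (fun _ hb => exists_mem_levelOfRecord_omegaOfRecord_eq_one L (ξ.bcη⁻¹ * μω) (1 : ↥(TorusDict.torus (IsCMField.complexConj L)) →ₜ* ℂˣ) (finCongruenceLevel_le_integralLevel (↥(maximalRealSubfield L)) L (IsCMField.complexConj L) 3 ((StdForm.antidiagonal 3).over L) 𝔫) hb) (fun _ hφ => continuous_of_mem_chiSectionSpace_levelOfRecord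 L (ξ.bcη⁻¹ * μω) (finCongruenceLevel_le_integralLevel (↥(maximalRealSubfield L)) L (IsCMField.complexConj L) 3 ((StdForm.antidiagonal 3).over L) 𝔫) (isOpen_finCongruenceLevel (↥(maximalRealSubfield L)) L (IsCMField.complexConj L) 3 ((StdForm.antidiagonal 3).over L) h𝔫) hφ) μa μf bV hbc hbM h2 hc (antidiagonal_over_det_ne_zero L 3) ξ.ψ ξ.hψ)ᶜ), ((Fam z : (quasiSplit (↥(maximalRealSubfield L)) L (IsCMField.complexConj L) 3).L2 μ) : (quasiSplit (↥(maximalRealSubfield L)) L (IsCMField.complexConj L) 3).automorphicQuotient → ℂ) =ᵐ[μ] (quasiSplit (↥(maximalRealSubfield L)) L (IsCMField.complexConj L) 3).quotFun (truncation ν 𝓕 T (fun x => midWitnessEc L μ νG ν h𝓕N h𝓕c h𝓕₀ hβ hμZ hφ₀V hφ₀c hφ₀M (levelOfRecord_le L (finCongruenceLevel (↥(maximalRealSubfield L)) L (IsCMField.complexConj L) 3 ((StdForm.antidiagonal 3).over L) 𝔫)) (archToAdelic_mem_levelOfRecord L (finCongruenceLevel (↥(maximalRealSubfield L)) L (IsCMField.complexConj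 L) 3 ((StdForm.antidiagonal 3).over L) 𝔫)) ((principalCongruenceLevel 3 L 𝔫).comap (GLn.ofFinite 3 L)) (isOpen_comap_ofFinite_principalCongruenceLevel 3 L h𝔫) (isCompact_comap_ofFinite_principalCongruenceLevel 3 L h𝔫) (fun _ hb => exists_mem_levelOfRecord_omegaOfRecord_eq_one L (ξ.bcη⁻¹ * μω) (1 : ↥(TorusDict.torus (IsCMField.complexConj L)) →ₜ* ℂˣ) (finCongruenceLevel_le_integralLevel (↥(maximalRealSubfield L)) L (IsCMField.complexConj L) 3 ((StdForm.antidiagonal 3).over L) 𝔫) hb) (fun _ hφ => continuous_of_mem_chiSectionSpace_levelOfRecord L (ξ.bcη⁻¹ * μω) (finCongruenceLevel_le_integralLevel (↥(maximalRealSubfield L)) L (IsCMField.complexConj L) 3 ((StdForm.antidiagonal 3).over L) 𝔫) (isOpen_finCongruenceLevel (↥(maximalRealSubfield L)) L (IsCMField.complexConj L) 3 ((StdForm.antidiagonal 3).over L) h𝔫) hφ) μa μf bV hbc hbM h2 hc (antidiagonal_over_det_ne_zero L 3) ξ.ψ ξ.hψ z x * ((detChar (↥(maximalRealSubfield L)) L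 (IsCMField.complexConj L) h2 hc 3 ((StdForm.antidiagonal 3).over L) ξ.ψ ξ.hψ (antidiagonal_over_det_ne_zero L 3) x : ℂˣ) : ℂ))))
    (hMS : ∃ C : ℝ, ∀ᶠ z in 𝓝[≠] ((3 : ℂ) / 2), ‖(z - (3 : ℂ) / 2) • Fam z‖ ≤ C) :
    LHalfNeZero (ξ.bcη⁻¹ * μω) → resGMidBlock L μ ξ μω ≠ ⊥ := by
  -- closedness and co-discreteness of the NAMED candidate pole set (★ `midWitnessExports_spec`, clauses 7, 8) at the level of record `K(𝔫)`
  obtain ⟨-, -, -, -, -, -, hPc, hPcd', -⟩ := midWitnessExports_spec L μ νG ν h𝓕N h𝓕c h𝓕₀ hβ hμZ hφ₀V hφ₀c hφ₀M (levelOfRecord_le L (finCongruenceLevel (↥(maximalRealSubfield L)) L (IsCMField.complexConj L) 3 ((StdForm.antidiagonal 3).over L) 𝔫)) (archToAdelic_mem_levelOfRecord L (finCongruenceLevel (↥(maximalRealSubfield L)) L (IsCMField.complexConj L) 3 ((StdForm.antidiagonal 3).over L) 𝔫)) ((principalCongruenceLevel 3 L 𝔫).comap (GLn.ofFinite 3 L))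 (isOpen_comap_ofFinite_principalCongruenceLevel 3 L h𝔫) (isCompact_comap_ofFinite_principalCongruenceLevel 3 L h𝔫) (fun _ hb => exists_mem_levelOfRecord_omegaOfRecord_eq_one L (ξ.bcη⁻¹ * μω) (1 : ↥(TorusDict.torus (IsCMField.complexConj L)) →ₜ* ℂˣ) (finCongruenceLevel_le_integralLevel (↥(maximalRealSubfield L)) L (IsCMField.complexConj L) 3 ((StdForm.antidiagonal 3).over L) 𝔫) hb) (fun _ hφ => continuous_of_mem_chiSectionSpace_levelOfRecord L (ξ.bcη⁻¹ * μω) (finCongruenceLevel_le_integralLevel (↥(maximalRealSubfield L)) L (IsCMField.complexConj L) 3 ((StdForm.antidiagonal 3).over L) 𝔫) (isOpen_finCongruenceLevel (↥(maximalRealSubfield L)) L (IsCMField.complexConj L) 3 ((StdForm.antidiagonal 3).over L) h𝔫) hφ) μa μf bV hbc hbM h2 hc (antidiagonal_over_det_ne_zero L 3) ξ.ψ ξ.hψ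
  -- the row-(ii) domain `D := ({1 < Re} ∖ {3∕2}) ∖ P` BY NAME: open, eventually near `3∕2` along the punctured filter, inside the slit half-plane
  have hDo : IsOpen (({z : ℂ | 1 < z.re} \ (↑({(3 : ℂ) / 2} : Finset ℂ) : Set ℂ)) ∩ (midWitnessP L μ νG ν h𝓕N h𝓕c h𝓕₀ hβ hμZ hφ₀V hφ₀c hφ₀M (levelOfRecord_le L (finCongruenceLevel (↥(maximalRealSubfield L)) L (IsCMField.complexConj L) 3 ((StdForm.antidiagonal 3).over L) 𝔫)) (archToAdelic_mem_levelOfRecord L (finCongruenceLevel (↥(maximalRealSubfield L)) L (IsCMField.complexConj L) 3 ((StdForm.antidiagonal 3).over L) 𝔫)) ((principalCongruenceLevel 3 L 𝔫).comap (GLn.ofFinite 3 L)) (isOpen_comap_ofFinite_principalCongruenceLevel 3 L h𝔫) (isCompact_comap_ofFinite_principalCongruenceLevel 3 L h𝔫) (fun _ hb => exists_mem_levelOfRecord_omegaOfRecord_eq_one L (ξ.bcη⁻¹ * μω) (1 : ↥(TorusDict.torus (IsCMField.complexConj L)) →ₜ* ℂˣ) (finCongruenceLevel_le_integralLevel (↥(maximalRealSubfield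 L)) L (IsCMField.complexConj L) 3 ((StdForm.antidiagonal 3).over L) 𝔫) hb) (fun _ hφ => continuous_of_mem_chiSectionSpace_levelOfRecord L (ξ.bcη⁻¹ * μω) (finCongruenceLevel_le_integralLevel (↥(maximalRealSubfield L)) L (IsCMField.complexConj L) 3 ((StdForm.antidiagonal 3).over L) 𝔫) (isOpen_finCongruenceLevel (↥(maximalRealSubfield L)) L (IsCMField.complexConj L) 3 ((StdForm.antidiagonal 3).over L) h𝔫) hφ) μa μf bV hbc hbM h2 hc (antidiagonal_over_det_ne_zero L 3) ξ.ψ ξ.hψ)ᶜ) :=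
    ((isOpen_lt continuous_const Complex.continuous_re).sdiff (Finset.finite_toSet _).isClosed).inter hPc.isOpen_compl
  have hre : ∀ᶠ z in 𝓝[≠] ((3 : ℂ) / 2), 1 < z.re :=
    eventually_nhdsWithin_of_eventually_nhds ((isOpen_lt continuous_const Complex.continuous_re).mem_nhds (by norm_num : (1 : ℝ) < ((3 : ℂ) / 2).re))
  have hD : ∀ᶠ z in 𝓝[≠] ((3 : ℂ) / 2), z ∈ (({z : ℂ | 1 < z.re} \ (↑({(3 : ℂ) / 2} : Finset ℂ) : Set ℂ)) ∩ (midWitnessP L μ νG ν h𝓕N h𝓕c h𝓕₀ hβ hμZ hφ₀V hφ₀c hφ₀M (levelOfRecord_le L (finCongruenceLevel (↥(maximalRealSubfield L)) L (IsCMField.complexConj L) 3 ((StdForm.antidiagonal 3).over L) 𝔫)) (archToAdelic_mem_levelOfRecord L (finCongruenceLevel (↥(maximalRealSubfield L)) L (IsCMField.complexConj L) 3 ((StdForm.antidiagonal 3).over L) 𝔫)) ((principalCongruenceLevel 3 L 𝔫).comap (GLn.ofFinite 3 L)) (isOpen_comap_ofFinite_principalCongruenceLevel 3 L h𝔫) (isCompact_comap_ofFinite_principalCongruenceLevel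 3 L h𝔫) (fun _ hb => exists_mem_levelOfRecord_omegaOfRecord_eq_one L (ξ.bcη⁻¹ * μω) (1 : ↥(TorusDict.torus (IsCMField.complexConj L)) →ₜ* ℂˣ) (finCongruenceLevel_le_integralLevel (↥(maximalRealSubfield L)) L (IsCMField.complexConj L) 3 ((StdForm.antidiagonal 3).over L) 𝔫) hb) (fun _ hφ => continuous_of_mem_chiSectionSpace_levelOfRecord L (ξ.bcη⁻¹ * μω) (finCongruenceLevel_le_integralLevel (↥(maximalRealSubfield L)) L (IsCMField.complexConj L) 3 ((StdForm.antidiagonal 3).over L) 𝔫) (isOpen_finCongruenceLevel (↥(maximalRealSubfield L)) L (IsCMField.complexConj L) 3 ((StdForm.antidiagonal 3).over L) h𝔫) hφ) μa μf bV hbc hbM h2 hc (antidiagonal_over_det_ne_zero L 3) ξ.ψ ξ.hψ)ᶜ) := by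
    filter_upwards [hre, hPcd' ((3 : ℂ) / 2), self_mem_nhdsWithin] with z hz hzP hne
    refine ⟨⟨hz, ?_⟩, hzP⟩
    rw [Finset.coe_singleton, Set.mem_singleton_iff]
    exact hne
  -- ★ `ledgerLetters_of_exports` (S8-R210 (2)): the pole ledger's two letters for `midWitnessEc·Θ` from the three untwisted letters, at the level of record
  obtain ⟨hbddPK, hbdd32⟩ := ledgerLetters_of_exports L μ νG ν h𝓕N h𝓕c h𝓕₀ hβ hμZ hφ₀V hφ₀c hφ₀M (levelOfRecord_le L (finCongruenceLevel (↥(maximalRealSubfield L)) L (IsCMField.complexConj L) 3 ((StdForm.antidiagonal 3).over L) 𝔫)) (archToAdelic_mem_levelOfRecord L (finCongruenceLevel (↥(maximalRealSubfield L)) L (IsCMField.complexConj L) 3 ((StdForm.antidiagonal 3).over L) 𝔫)) ((principalCongruenceLevel 3 L 𝔫).comap (GLn.ofFinite 3 L)) (isOpen_comap_ofFinite_principalCongruenceLevel 3 L h𝔫) (isCompact_comap_ofFinite_principalCongruenceLevel 3 L h𝔫) (fun _ hb => exists_mem_levelOfRecord_omegaOfRecord_eq_one L (ξ.bcη⁻¹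 * μω) (1 : ↥(TorusDict.torus (IsCMField.complexConj L)) →ₜ* ℂˣ) (finCongruenceLevel_le_integralLevel (↥(maximalRealSubfield L)) L (IsCMField.complexConj L) 3 ((StdForm.antidiagonal 3).over L) 𝔫) hb) (fun _ hφ => continuous_of_mem_chiSectionSpace_levelOfRecord L (ξ.bcη⁻¹ * μω) (finCongruenceLevel_le_integralLevel (↥(maximalRealSubfield L)) L (IsCMField.complexConj L) 3 ((StdForm.antidiagonal 3).over L) 𝔫) (isOpen_finCongruenceLevel (↥(maximalRealSubfield L)) L (IsCMField.complexConj L) 3 ((StdForm.antidiagonal 3).over L) h𝔫) hφ) μa μf bV hbc hbM h2 hc (antidiagonal_over_det_ne_zero L 3) ξ.ψ ξ.hψ hE6 hMSP' hMS32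
  -- the right character of record as a monoid hom (★ p864091 `omegaOfRecord_one`, `omegaOfRecord_mul`)
  let ω₀ : ↥(levelOfRecord L (finCongruenceLevel (↥(maximalRealSubfield L)) L (IsCMField.complexConj L) 3 ((StdForm.antidiagonal 3).over L) 𝔫)) →* ℂ :=
    { toFun := (omegaOfRecord L (ξ.bcη⁻¹ * μω) (1 : ↥(TorusDict.torus (IsCMField.complexConj L)) →ₜ* ℂˣ) (finCongruenceLevel (↥(maximalRealSubfield L)) L (IsCMField.complexConj L) 3 ((StdForm.antidiagonal 3).over L) 𝔫))
      map_one' := omegaOfRecord_one L (ξ.bcη⁻¹ * μω) (1 : ↥(TorusDict.torus (IsCMField.complexConj L)) →ₜ* ℂˣ) (finCongruenceLevel (↥(maximalRealSubfield L)) L (IsCMField.complexConj L) 3 ((StdForm.antidiagonal 3).over L) 𝔫)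
      map_mul' := omegaOfRecord_mul L (ξ.bcη⁻¹ * μω) (1 : ↥(TorusDict.torus (IsCMField.complexConj L)) →ₜ* ℂˣ) (finCongruenceLevel (↥(maximalRealSubfield L)) L (IsCMField.complexConj L) 3 ((StdForm.antidiagonal 3).over L) 𝔫) }
  exact resGMidBlock_ne_bot_of_ledger_letters L μ μω hμu hμω ξ νG ν h𝓕N h𝓕c h𝓕₀ hβ hμZ μa μf h2 hc (antidiagonal_over_det_ne_zero L 3) (levelOfRecord L (finCongruenceLevel (↥(maximalRealSubfield L)) L (IsCMField.complexConj L) 3 ((StdForm.antidiagonal 3).over L) 𝔫)) ω₀ hφ₀V hφ₀c hφ₀M (levelOfRecord_le L (finCongruenceLevel (↥(maximalRealSubfield L)) L (IsCMField.complexConj L) 3 ((StdForm.antidiagonal 3).over L) 𝔫))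
    (archToAdelic_mem_levelOfRecord L (finCongruenceLevel (↥(maximalRealSubfield L)) L (IsCMField.complexConj L) 3 ((StdForm.antidiagonal 3).over L) 𝔫)) ((principalCongruenceLevel 3 L 𝔫).comap (GLn.ofFinite 3 L)) (isOpen_comap_ofFinite_principalCongruenceLevel 3 L h𝔫) (isCompact_comap_ofFinite_principalCongruenceLevel 3 L h𝔫) (fun _ hb => exists_mem_levelOfRecord_omegaOfRecord_eq_one L (ξ.bcη⁻¹ * μω) (1 : ↥(TorusDict.torus (IsCMField.complexConj L)) →ₜ* ℂˣ) (finCongruenceLevel_le_integralLevel (↥(maximalRealSubfield L)) L (IsCMField.complexConj L) 3 ((StdForm.antidiagonal 3).over L) 𝔫) hb)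
    (fun _ hφ => continuous_of_mem_chiSectionSpace_levelOfRecord L (ξ.bcη⁻¹ * μω) (finCongruenceLevel_le_integralLevel (↥(maximalRealSubfield L)) L (IsCMField.complexConj L) 3 ((StdForm.antidiagonal 3).over L) 𝔫) (isOpen_finCongruenceLevel (↥(maximalRealSubfield L)) L (IsCMField.complexConj L) 3 ((StdForm.antidiagonal 3).over L) h𝔫) hφ) bV hbc hbM hbddPK hbdd32
    hDo hD Set.inter_subset_left ψ φt hE3 q qc hqcq hPcd hqa hfac hφt hg₀ hφtbd hS hurφ hT' hurη
    (fun z : ℂ => (C * ∏ v ∈ S₀, ((Measure.pi fun _ : Fin 3 => νv v) (integralBox ↥(maximalRealSubfield L) (Fin 3) v)).toReal⁻¹ •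
            ∫ p : Fin 3 → v.adicCompletion ↥(maximalRealSubfield L),
              Set.indicator {p : Fin 3 → v.adicCompletion ↥(maximalRealSubfield L) | p ∈ integralBox ↥(maximalRealSubfield L) (Fin 3) v ∧ ∀ w' : PlacesOver L v,
                  Valued.v (quadraticLocalEquiv L v (IsCMField.complexConj L) hcδ hδ (p 0, p 1) w') ≤ idealRadius L w'.1 𝔫 ∧
                  Valued.v (conjLocal L (IsCMField.complexConj L) v (quadraticLocalEquiv L v (IsCMField.complexConj L) hcδ hδ (p 0, p 1)) w') ≤ idealRadius L w'.1 𝔫 ∧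
                  Valued.v ((toLocalRing L v (p 2) * algebraMap L (LocalRing L v) δ -
                    toLocalRing L v 2⁻¹ * (quadraticLocalEquiv L v (IsCMField.complexConj L) hcδ hδ (p 0, p 1) * conjLocal L (IsCMField.complexConj L) v (quadraticLocalEquiv L v (IsCMField.complexConj L) hcδ hδ (p 0, p 1)))) w') ≤ idealRadius L w'.1 𝔫}
                (fun _ => (1 : ℂ)) p *
              (((∏ w' : PlacesOver L v, max 1 (max ((normAbs (w'.1.adicCompletion L) (quadraticLocalEquiv L v (IsCMField.complexConj L) hcδ hδ (p 0, p 1) w') : ℝ≥0) : ℝ)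
                ((normAbs (w'.1.adicCompletion L) ((toLocalRing L v (p 2) * algebraMap L (LocalRing L v) δ -
                  toLocalRing L v 2⁻¹ * (quadraticLocalEquiv L v (IsCMField.complexConj L) hcδ hδ (p 0, p 1) *
                    conjLocal L (IsCMField.complexConj L) v (quadraticLocalEquiv L v (IsCMField.complexConj L) hcδ hδ (p 0, p 1)))) w') : ℝ≥0) : ℝ))) : ℝ) : ℂ) ^ (-z) ∂(Measure.pi fun _ : Fin 3 => νv v)) *
          ∫ Xi : InfiniteAdeleRing L, ∫ a : InfiniteAdeleRing ↥(maximalRealSubfield L),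
          (∏ w : InfinitePlace L, ε w * archUnitaryValue (kμ w - 2 * ξ.eη w) 0 ((((-(1 + ‖Xi w‖ ^ 2 / 2)) : ℝ) : ℂ) + (((w.embedding δ).im * ((InfiniteAdeleRing.ringEquiv_mixedSpace ↥(maximalRealSubfield L)) a).1 ⟨w.comap (algebraMap ↥(maximalRealSubfield L) L), Summit.HodgeConjecture.HodgeConjecture.Cruxes.H413.K2E1HeightBigCellLineFormulaU2.isReal_comap_maximalRealSubfield L w⟩ : ℝ) : ℂ) * Complex.I) * (((2 : ℂ) + ((((-(1 + ‖Xi w‖ ^ 2 / 2)) : ℝ) : ℂ) + (((w.embedding δ).im * ((InfiniteAdeleRing.ringEquiv_mixedSpace ↥(maximalRealSubfield L)) a).1 ⟨w.comap (algebraMap ↥(maximalRealSubfield L) L), Summit.HodgeConjecture.HodgeConjecture.Cruxes.H413.K2E1HeightBigCellLineFormulaU2.isReal_comap_maximalRealSubfield L w⟩ : ℝ) : ℂ) * Complex.I)) / ((((-(1 + ‖Xi w‖ ^ 2 / 2)) : ℝ) : ℂ) + (((w.embedding δ).im * ((InfiniteAdeleRing.ringEquiv_mixedSpace ↥(maximalRealSubfield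 L)) a).1 ⟨w.comap (algebraMap ↥(maximalRealSubfield L) L), Summit.HodgeConjecture.HodgeConjecture.Cruxes.H413.K2E1HeightBigCellLineFormulaU2.isReal_comap_maximalRealSubfield L w⟩ : ℝ) : ℂ) * Complex.I)) ^ (((kμ w - 2 * ξ.eη w) - 1) / 2).toNat * (((2 : ℂ) + conj ((((-(1 + ‖Xi w‖ ^ 2 / 2)) : ℝ) : ℂ) + (((w.embedding δ).im * ((InfiniteAdeleRing.ringEquiv_mixedSpace ↥(maximalRealSubfield L)) a).1 ⟨w.comap (algebraMap ↥(maximalRealSubfield L) L), Summit.HodgeConjecture.HodgeConjecture.Cruxes.H413.K2E1HeightBigCellLineFormulaU2.isReal_comap_maximalRealSubfield L w⟩ : ℝ) : ℂ) * Complex.I)) / conj ((((-(1 + ‖Xi w‖ ^ 2 / 2)) : ℝ) : ℂ) + (((w.embedding δ).im * ((InfiniteAdeleRing.ringEquiv_mixedSpace ↥(maximalRealSubfield L)) a).1 ⟨w.comap (algebraMap ↥(maximalRealSubfield L) L), Summit.HodgeConjecture.HodgeConjecture.Cruxes.H413.K2E1HeightBigCellLineFormulaU2.isReal_comap_maximalRealSubfield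 L w⟩ : ℝ) : ℂ) * Complex.I)) ^ ((-(kμ w - 2 * ξ.eη w) - 1) / 2).toNat) *
            ((((∏ w : InfinitePlace L, ((1 + ‖(Xi) w‖ ^ 2 / 2) ^ 2 + (w δ) ^ 2 * (((InfiniteAdeleRing.ringEquiv_mixedSpace ↥(maximalRealSubfield L)) a).1 ⟨w.comap (algebraMap ↥(maximalRealSubfield L) L), Summit.HodgeConjecture.HodgeConjecture.Cruxes.H413.K2E1HeightBigCellLineFormulaU2.isReal_comap_maximalRealSubfield L w⟩) ^ 2))) : ℝ) : ℂ) ^ (-z) ∂μF₁ ∂μE₁) hA hsrc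
    (hA32_shifted_of_record_at_basePoint_of_modEq L hcδ hδ 𝔫 νv μE₁ μF₁ ξ kμ hk ε hε1 hε0 S₀ hC) hT Fam hFd hFam hMS

end Summit.HodgeConjecture.HodgeConjecture.R90.S8

end
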